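/-
Copyright: seat `ym-line-cbag-p2` (prover-ym-line-cbag-p2-g2-0), route `ColdBoxAllGroups`, crux `BulkAllGroups`
(stmt-QuantumFields-22255), line `dlr-chessboard-G` (skeleton `Cruxes/BulkAllGroups/Lines/birth.lean` v5).
-/
import Summits.QuantumFields.YangMills.Theorems.ColdBoxAllGroupsBulkAllGroupsRepresentationDatumG
import Summits.QuantumFields.YangMills.Theorems.ColdBoxAllGroupsBulkAllGroupsKernelCovCoreMomentsG
import Summits.QuantumFields.YangMills.Theorems.ColdBoxAllGroupsBulkAllGroupsTiltBoundDatumG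
import Summits.QuantumFields.YangMills.Theorems.ColdBoxAllGroupsBoxFloorAllGroupsCoreG
import Summits.QuantumFields.YangMills.Theorems.ColdBoxAllGroupsBoxFloorAllGroupsChartWindowG
import Summits.QuantumFields.YangMills.Theorems.WeakCouplingRatesColdBoxColourCov
import Summits.QuantumFields.YangMills.Theorems.WeakCouplingRatesColdBoxGaussMoments

/-!
# Crux `BulkAllGroups` (stmt-QuantumFields-22255), stub `stub_kernelCovExpansionG`: the one-scale expansion of the kernel COVARIANCE with
# datum ASSEMBLED at fixed `β` — the deterministic core with datum, every compact group presented in `U(N)`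

`G`-generic port of `Theorems/WeakCouplingRatesBulkDominatesColdBoxWKernelCovDatumCore.lean` (`SU(2)`, gnomonic chart, three colours), i.e. the
ϑ-twin of the sibling crux's flat core `abs_boxPlaqCov_sub_dirCircSqCov_le_coreG`.  For the DLR box kernel `γ(·|W) = boxKernelG ρ β H W` of a
faithful continuous unitary `ρ : G →* U(N)` (`D = dimE ρ` colours) with an exterior datum in chart form off the cold box
(`W e = expChart ρ (datVec ϑ e)`, `‖datVec ϑ e‖ ≤ r` off `Λ = boxEdges 4 (2H+1)`), at the centre pair `p₁ = (boxCentre H; 1,2)`,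
`p₂ = p₁ + T e₀` (`T ≤ H`), given
* the T3 inputs (`…RepresentationDatumG`): the link window `hball` at radius `m ≤ 1/4`, a chart density `c·g` on the chart ball (`hdens`, `g > 0`
  there), and the YM bad mass `γ(·|W)((coldGoodSetG)ᶜ) ≤ pY < 1`;
* REAL inputs on the Gaussian window `S = goodTDE ρ H β ε ϑ ∩ {t | ∀ e, ‖unscaleTE H D β (t + μ') e‖ ≤ m}`, to be discharged by the datum bricks of
  the line (T4 tilt bound `|tiltWDE| ≤ w` on `S`; R3-datum surrogate accuracy `|qObsDE p t − β·c_p(cfgTDE t)| ≤ τ` on `S` at `p₁, p₂`; the goodTDE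
  sandwich `gaussD(Sᶜ) ≤ P < 1`) and a bound `R'` on the scaled background circulations `F'_c(p_i) = sCirc(glue ϑ'_c (mean ϑ'_c))(p_i)`,
  `ϑ' = sdatE β ϑ`,
**`abs_kernelCovG_sub_gaussian_le_datum`**:

  `|β²·Cov_{γ(·|W)}(c_{p₁}, c_{p₂}) − ((D/2)·C² + (Σ_c F'_c(p₁)F'_c(p₂))·C)| ≤ 6(2Nβ)²·pY + 3M²(e^{2w}−1) + 6M²·P + 2τ(M + K₁) + √P·(2MK₁ + K₂ + K₁²)`,

`C = boxDirProjKernel H p₁ p₂`, `M = β^{2ε}`, `K₁ = 2D(R'² + 2)`, `K₂ = 3D²(R'⁴ + 11)`.  Chain: T3' `integral_cond_boxKernelG_eq_integral_tilted_datum'`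
(×3), the on-`S` bound `beta_mul_plaqCostAt_mem_Icc_of_mem_goodTDE` (w2, `…TiltBoundDatumG`), the cores' form of the surrogate `qObsDE_eq_half_sum_sq`, the abstract
`D`-colour core with moments `abs_kernelCovG_sub_gaussian_le_moments`, and the polynomial bounds `moment_consts_le` for its Gaussian moment
constants (`|F'_c| ≤ R'`, `0 ≤ C(p,p) ≤ 1` at the centre pair).  The cross term is left in scaled units (`Σ_c F'_c F'_c = β·Σ_c F̄_c F̄_c`,
`sum_sqrt_smul_mul_eq`); the stub file converts.  No sorry; no new definition; standard axioms.  NOT a claim about the mass gap: rung-level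
support (R2xi-G `XiPow`, RECORD label); the Yang–Mills mass gap is NOT proved by any of this.
-/

set_option autoImplicit false

noncomputable section

open MeasureTheory ProbabilityTheory Finset Real Metric
open scoped ENNReal Matrix.Norms.Frobenius
open Literature.Probability.LatticeModels (Site)
open Literature.MathematicalPhysics.QuantumLattice
open Literature.MathematicalPhysics.QuantumFieldTheory
open Literature.MathematicalPhysics.QuantumFieldTheory.LatticeMaxwell
open Literature.MathematicalPhysics.QuantumFieldTheory.AxialGauge
open Summit.QuantumFields.YangMills.Theorems.WeakCouplingRates
open Summit.QuantumFields.YangMills.Theorems.FreeEnergyLogCoefficient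

namespace Summit.QuantumFields.YangMills.Theorems.ColdBoxAllGroups

variable {H : ℕ}

/-! ## Bounds for the Gaussian moment constants of the `D`-colour core -/

/-- **Polynomial bounds for the moment constants** of `abs_kernelCovG_sub_gaussian_le_moments`: if `|F_c|, |G_c| ≤ R'` (`R' ≥ 0`) and
`a, b ∈ [0,1]` then, with `K₁ = 2D(R'²+2)` and `K₂ = 3D²(R'⁴+11)`,
`2DΣ_c(F_c⁴+3a²) + 2DΣ_c(G_c⁴+3b²) ≤ K₁²` (hence its square root is `≤ K₁`) and `√((8D³Σ_c(F_c⁸+105a⁴) + 8D³Σ_c(G_c⁸+105b⁴))/2) ≤ K₂`. -/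
theorem moment_consts_le {D : ℕ} {F G : Fin D → ℝ} {R' a b : ℝ} (hR' : 0 ≤ R') (hF : ∀ c, |F c| ≤ R') (hG : ∀ c, |G c| ≤ R')
    (ha : 0 ≤ a) (ha1 : a ≤ 1) (hb : 0 ≤ b) (hb1 : b ≤ 1) :
    2 * (D : ℝ) * ∑ c, (F c ^ 4 + 3 * a ^ 2) + 2 * D * ∑ c, (G c ^ 4 + 3 * b ^ 2) ≤ (2 * D * (R' ^ 2 + 2)) ^ 2 ∧
      Real.sqrt (2 * (D : ℝ) * ∑ c, (F c ^ 4 + 3 * a ^ 2) + 2 * D * ∑ c, (G c ^ 4 + 3 * b ^ 2)) ≤ 2 * D * (R' ^ 2 + 2) ∧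
      Real.sqrt ((8 * (D : ℝ) ^ 3 * ∑ c, (F c ^ 8 + 105 * a ^ 4) + 8 * (D : ℝ) ^ 3 * ∑ c, (G c ^ 8 + 105 * b ^ 4)) / 2) ≤
        3 * (D : ℝ) ^ 2 * (R' ^ 4 + 11) := by
  have hD0 : (0 : ℝ) ≤ D := Nat.cast_nonneg _
  have hpow : ∀ {u : ℝ} (n : ℕ), Even n → |u| ≤ R' → u ^ n ≤ R' ^ n := fun {u} n hn hu => by
    have h := pow_le_pow_left₀ (abs_nonneg _) hu n
    rwa [pow_abs, abs_of_nonneg (hn.pow_nonneg u)] at h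
  have h4e : Even 4 := by decide
  have h8e : Even 8 := by decide
  have hF4 : ∀ c, F c ^ 4 ≤ R' ^ 4 := fun c => hpow 4 h4e (hF c)
  have hG4 : ∀ c, G c ^ 4 ≤ R' ^ 4 := fun c => hpow 4 h4e (hG c)
  have hF8 : ∀ c, F c ^ 8 ≤ R' ^ 8 := fun c => hpow 8 h8e (hF c)
  have hG8 : ∀ c, G c ^ 8 ≤ R' ^ 8 := fun c => hpow 8 h8e (hG c)
  have ha2 : a ^ 2 ≤ 1 := by nlinarith
  have hb2 : b ^ 2 ≤ 1 := by nlinarith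
  have ha4 : a ^ 4 ≤ 1 := pow_le_one₀ ha ha1
  have hb4 : b ^ 4 ≤ 1 := pow_le_one₀ hb hb1
  have hs1 : ∑ c, (F c ^ 4 + 3 * a ^ 2) ≤ ∑ _c : Fin D, (R' ^ 4 + 3) := Finset.sum_le_sum fun c _ => by linarith [hF4 c]
  have hs2 : ∑ c, (G c ^ 4 + 3 * b ^ 2) ≤ ∑ _c : Fin D, (R' ^ 4 + 3) := Finset.sum_le_sum fun c _ => by linarith [hG4 c]
  have hs3 : ∑ c, (F c ^ 8 + 105 * a ^ 4) ≤ ∑ _c : Fin D, (R' ^ 8 + 105) := Finset.sum_le_sum fun c _ => by linarith [hF8 c]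
  have hs4 : ∑ c, (G c ^ 8 + 105 * b ^ 4) ≤ ∑ _c : Fin D, (R' ^ 8 + 105) := Finset.sum_le_sum fun c _ => by linarith [hG8 c]
  rw [Finset.sum_const, Finset.card_univ, Fintype.card_fin, nsmul_eq_mul] at hs1 hs2 hs3 hs4
  have hK1sq : 2 * (D : ℝ) * ∑ c, (F c ^ 4 + 3 * a ^ 2) + 2 * D * ∑ c, (G c ^ 4 + 3 * b ^ 2) ≤ (2 * D * (R' ^ 2 + 2)) ^ 2 := by
    have h1 : 2 * (D : ℝ) * ∑ c, (F c ^ 4 + 3 * a ^ 2) ≤ 2 * D * (D * (R' ^ 4 + 3)) := mul_le_mul_of_nonneg_left hs1 (by positivity)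
    have h2 : 2 * (D : ℝ) * ∑ c, (G c ^ 4 + 3 * b ^ 2) ≤ 2 * D * (D * (R' ^ 4 + 3)) := mul_le_mul_of_nonneg_left hs2 (by positivity)
    nlinarith [sq_nonneg R', sq_nonneg (D : ℝ), mul_nonneg hD0 hD0, mul_nonneg (mul_nonneg hD0 hD0) (sq_nonneg R')]
  refine ⟨hK1sq, (Real.sqrt_le_sqrt hK1sq).trans_eq (Real.sqrt_sq (by positivity)), ?_⟩
  have hK2sq : (8 * (D : ℝ) ^ 3 * ∑ c, (F c ^ 8 + 105 * a ^ 4) + 8 * (D : ℝ) ^ 3 * ∑ c, (G c ^ 8 + 105 * b ^ 4)) / 2 ≤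
      (3 * (D : ℝ) ^ 2 * (R' ^ 4 + 11)) ^ 2 := by
    have h1 : 8 * (D : ℝ) ^ 3 * ∑ c, (F c ^ 8 + 105 * a ^ 4) ≤ 8 * (D : ℝ) ^ 3 * (D * (R' ^ 8 + 105)) :=
      mul_le_mul_of_nonneg_left hs3 (by positivity)
    have h2 : 8 * (D : ℝ) ^ 3 * ∑ c, (G c ^ 8 + 105 * b ^ 4) ≤ 8 * (D : ℝ) ^ 3 * (D * (R' ^ 8 + 105)) :=
      mul_le_mul_of_nonneg_left hs4 (by positivity)
    have hD4 : 0 ≤ (D : ℝ) ^ 4 := by positivity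
    nlinarith [pow_nonneg hR' 4, pow_nonneg hR' 8, mul_nonneg hD4 (pow_nonneg hR' 4), mul_nonneg hD4 (pow_nonneg hR' 8)]
  exact (Real.sqrt_le_sqrt hK2sq).trans_eq (Real.sqrt_sq (by positivity))

/-! ## The core with datum at fixed `β` -/

section Box

variable {N : ℕ} {G : Type} [Group G] (ρ : G →* Matrix (Fin N) (Fin N) ℂ)

variable [TopologicalSpace G] [IsTopologicalGroup G] [CompactSpace G] [MeasurableSpace G] [BorelSpace G] [SecondCountableTopology G]

set_option maxHeartbeats 400000 in
/-- **The one-scale expansion of the kernel covariance with datum, assembled at fixed `β` (deterministic core), every compact group presented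
in `U(N)`.**  See the module docstring: every analytic input is a tree theorem (T3', the on-`S` bound, the `D`-colour core with moments); the
hypotheses left are the T3 inputs, three REAL inputs on the Gaussian window `S` (tilt bound `w`, surrogate accuracy `τ` at the two centre
plaquettes, bad mass `P`), the YM bad mass `pY`, and the background bound `R'` — discharged (eventually in `β`) by the stub file. -/
theorem abs_kernelCovG_sub_gaussian_le_datum (hρc : Continuous ρ) (hinj : Function.Injective ρ)
    (hρu : ∀ g, ρ g ∈ Matrix.unitaryGroup (Fin N) ℂ) {β ε r m w τ R' P pY : ℝ} {T : ℕ}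
    {g : EuclideanSpace ℝ (Fin (dimE ρ)) → ℝ} (hgm : Measurable g)
    (hβ : 1 ≤ β) (hH : 1 ≤ H) (hT : T ≤ H) (hr : 0 ≤ r) (hm4 : m ≤ 1 / 4)
    {W : LGConfig 4 G} {ϑ : Fin (dimE ρ) → (Literature.MathematicalPhysics.QuantumLattice.ZdEdge 4 → ℝ)}
    (hW : ∀ e, e ∉ boxEdges 4 (2 * H + 1) → W e = expChart ρ (datVec ϑ e))
    (hϑ : ∀ e, e ∉ boxEdges 4 (2 * H + 1) → ‖datVec ϑ e‖ ≤ r)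
    (hball : ∀ u : G, ‖ρ u - 1‖ ≤ (12 * (H : ℝ) ^ 2 + 2 * H + 1) * (Real.sqrt 2 * Real.sqrt (β ^ (2 * ε - 1)) + 8 * r) →
      u ∈ expChart ρ '' closedBall (0 : EuclideanSpace ℝ (Fin (dimE ρ))) m)
    (hgpos : ∀ a, ‖a‖ ≤ m → 0 < g a) {c : ℝ≥0∞} (hc0 : c ≠ 0) (hctop : c ≠ ∞)
    (hdens : (chartMeasureE ρ (1 / 4)).restrict (closedBall 0 m) =
      (c • (volume : Measure (EuclideanSpace ℝ (Fin (dimE ρ)))).restrict (closedBall 0 m)).withDensity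
        (fun a => ENNReal.ofReal (g a)))
    (hpY : (boxKernelG ρ β H W).real (coldGoodSetG ρ H β ε)ᶜ ≤ pY) (hpY1 : pY < 1)
    (hP : (gaussD H (dimE ρ)).real
        (goodTDE ρ H β ε ϑ ∩ {t | ∀ e, ‖unscaleTE H (dimE ρ) β (t + meanTE H (dimE ρ) β ϑ) e‖ ≤ m})ᶜ ≤ P) (hP1 : P < 1)
    (hWb : ∀ t ∈ goodTDE ρ H β ε ϑ ∩ {t | ∀ e, ‖unscaleTE H (dimE ρ) β (t + meanTE H (dimE ρ) β ϑ) e‖ ≤ m},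
      |tiltWDE ρ H g β ϑ t| ≤ w)
    (hτ : 0 ≤ τ)
    (hSur₁ : ∀ t ∈ goodTDE ρ H β ε ϑ ∩ {t | ∀ e, ‖unscaleTE H (dimE ρ) β (t + meanTE H (dimE ρ) β ϑ) e‖ ≤ m},
      |qObsDE H (dimE ρ) β ϑ (boxCentre H, 1, 2) t - β * plaqCostAt ρ (boxCentre H) 1 2 (cfgTDE ρ H β ϑ t)| ≤ τ)
    (hSur₂ : ∀ t ∈ goodTDE ρ H β ε ϑ ∩ {t | ∀ e, ‖unscaleTE H (dimE ρ) β (t + meanTE H (dimE ρ) β ϑ) e‖ ≤ m},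
      |qObsDE H (dimE ρ) β ϑ (boxCentre H + Pi.single 0 (T : ℤ), 1, 2) t -
        β * plaqCostAt ρ (boxCentre H + Pi.single 0 (T : ℤ)) 1 2 (cfgTDE ρ H β ϑ t)| ≤ τ)
    (hR'0 : 0 ≤ R')
    (hF₁ : ∀ c, |sCirc (glue (pin := fun e => e ∉ dirFreeEdges H) dirCorner (2 * H + 3) (sdatE β ϑ c)
        (mean (fun e => e ∉ dirFreeEdges H) dirCorner (2 * H + 3) (sdatE β ϑ c))) (boxCentre H, 1, 2)| ≤ R')
    (hF₂ : ∀ c, |sCirc (glue (pin := fun e => e ∉ dirFreeEdges H) dirCorner (2 * H + 3) (sdatE β ϑ c)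
        (mean (fun e => e ∉ dirFreeEdges H) dirCorner (2 * H + 3) (sdatE β ϑ c))) (boxCentre H + Pi.single 0 (T : ℤ), 1, 2)| ≤ R') :
    |β ^ 2 * ((∫ U, plaqCostAt ρ (boxCentre H) 1 2 U * plaqCostAt ρ (boxCentre H + Pi.single 0 (T : ℤ)) 1 2 U ∂(boxKernelG ρ β H W)) -
          (∫ U, plaqCostAt ρ (boxCentre H) 1 2 U ∂(boxKernelG ρ β H W)) *
            (∫ U, plaqCostAt ρ (boxCentre H + Pi.single 0 (T : ℤ)) 1 2 U ∂(boxKernelG ρ β H W))) -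
        ((dimE ρ : ℝ) / 2 * boxDirProjKernel H (boxCentre H, 1, 2) (boxCentre H + Pi.single 0 (T : ℤ), 1, 2) ^ 2 +
          (∑ c, sCirc (glue (pin := fun e => e ∉ dirFreeEdges H) dirCorner (2 * H + 3) (sdatE β ϑ c)
                (mean (fun e => e ∉ dirFreeEdges H) dirCorner (2 * H + 3) (sdatE β ϑ c))) (boxCentre H, 1, 2) *
              sCirc (glue (pin := fun e => e ∉ dirFreeEdges H) dirCorner (2 * H + 3) (sdatE β ϑ c)
                (mean (fun e => e ∉ dirFreeEdges H) dirCorner (2 * H + 3) (sdatE β ϑ c))) (boxCentre H + Pi.single 0 (T : ℤ), 1, 2)) *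
            boxDirProjKernel H (boxCentre H, 1, 2) (boxCentre H + Pi.single 0 (T : ℤ), 1, 2))| ≤
      6 * (2 * N * β) * (2 * N * β) * pY +
        (3 * (β ^ (2 * ε)) ^ 2 * (Real.exp (2 * w) - 1) + 6 * (β ^ (2 * ε)) ^ 2 * P +
          2 * τ * (β ^ (2 * ε) + 2 * (dimE ρ) * (R' ^ 2 + 2)) +
          Real.sqrt P * (2 * β ^ (2 * ε) * (2 * (dimE ρ) * (R' ^ 2 + 2)) + 3 * (dimE ρ : ℝ) ^ 2 * (R' ^ 4 + 11) +
            (2 * (dimE ρ) * (R' ^ 2 + 2)) ^ 2)) := by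
  have hβ0 : 0 < β := by linarith
  -- abbreviations
  set μ := boxKernelG ρ β H W with hμ
  set Gd := coldGoodSetG ρ H β ε with hGd
  set γ : Measure (TSpaceD H (dimE ρ)) := gaussD H (dimE ρ) with hγ
  set S : Set (TSpaceD H (dimE ρ)) := goodTDE ρ H β ε ϑ ∩
    {t | ∀ e, ‖unscaleTE H (dimE ρ) β (t + meanTE H (dimE ρ) β ϑ) e‖ ≤ m} with hS
  set x₁ : Site 4 := boxCentre H with hx₁
  set x₂ : Site 4 := boxCentre H + Pi.single 0 (T : ℤ) with hx₂
  set Fb : Fin (dimE ρ) → ℝ := fun c => sCirc (glue (pin := fun e => e ∉ dirFreeEdges H) dirCorner (2 * H + 3) (sdatE β ϑ c)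
      (mean (fun e => e ∉ dirFreeEdges H) dirCorner (2 * H + 3) (sdatE β ϑ c))) (x₁, 1, 2) with hFb
  set Gb : Fin (dimE ρ) → ℝ := fun c => sCirc (glue (pin := fun e => e ∉ dirFreeEdges H) dirCorner (2 * H + 3) (sdatE β ϑ c)
      (mean (fun e => e ∉ dirFreeEdges H) dirCorner (2 * H + 3) (sdatE β ϑ c))) (x₂, 1, 2) with hGb
  set M : ℝ := β ^ (2 * ε) with hM
  have hM0 : 0 ≤ M := by positivity
  have hD0 : (0 : ℝ) ≤ (dimE ρ : ℝ) := Nat.cast_nonneg _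
  -- measurability and the two charged events
  have hGm : MeasurableSet Gd := measurableSet_coldGoodSetG ρ hρc β ε
  have hSm : MeasurableSet S :=
    (measurableSet_goodTDE ρ hρc hinj β ε ϑ).inter (measurableSet_ball_unscaleTE_add (dimE ρ) β m _)
  haveI : IsProbabilityMeasure μ := isProbabilityMeasure_boxKernelG ρ hρc β H W
  haveI : IsProbabilityMeasure γ := isProbabilityMeasure_gaussD H (dimE ρ)
  have hG0 : μ Gd ≠ 0 := measure_ne_zero_of_real_compl_lt_one μ hGm (hpY.trans_lt hpY1)
  have hS0 : γ S ≠ 0 := measure_ne_zero_of_real_compl_lt_one γ hSm (hP.trans_lt hP1)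
  -- the three representation identities (T3')
  have hmeas : ∀ (x : Site 4), Measurable fun U : LGConfig 4 G => β * plaqCostAt ρ x 1 2 U := fun x =>
    (measurable_plaqCostAt_of_continuous ρ hρc x 1 2).const_mul β
  have hnn : ∀ (x : Site 4) (U : LGConfig 4 G), 0 ≤ β * plaqCostAt ρ x 1 2 U := fun x U => by
    refine mul_nonneg hβ0.le ?_
    simp only [plaqCostAt, plaquetteObs]
    rw [Literature.MathematicalPhysics.QuantumFieldTheory.sub_re_trace_eq_half_norm_sub_one_sq (hρu _)]
    positivity
  have hrep : ∀ X : LGConfig 4 G → ℝ, Measurable X → IsZdGaugeInvariant X → (∀ U, 0 ≤ X U) →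
      ∫ U, X U ∂(μ[|Gd]) = ∫ t, X (cfgTDE ρ H β ϑ t) ∂((γ[|S]).tilted (S.indicator (tiltWDE ρ H g β ϑ))) :=
    fun X hXm hXinv hX0 => integral_cond_boxKernelG_eq_integral_tilted_datum' ρ hρc hinj hρu hβ0 hH hr hm4 hball hW hϑ hgm hgpos hc0
      hctop hdens hG0 hS0 hXm hXinv hX0
  have hrepF := hrep _ (hmeas x₁) (isZdGaugeInvariant_const_mul_plaqCostAtG ρ β x₁ 1 2) (hnn x₁)
  have hrepG := hrep _ (hmeas x₂) (isZdGaugeInvariant_const_mul_plaqCostAtG ρ β x₂ 1 2) (hnn x₂)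
  have hrepFG := hrep _ ((hmeas x₁).mul (hmeas x₂)) (isZdGaugeInvariant_const_mul_plaqCostAt_mulG ρ β x₁ x₂ 1 2 1 2)
    (fun U => mul_nonneg (hnn x₁ U) (hnn x₂ U))
  -- the tilt bound (indicator form), the on-`S` bounds and the surrogates
  have hPc := centre_mem_plaquettesTouching hH hT
  have hw0 : 0 ≤ w := by
    by_cases hne : S.Nonempty
    · obtain ⟨t, ht⟩ := hne; exact (abs_nonneg _).trans (hWb t ht)
    · exfalso; apply hS0; rw [Set.not_nonempty_iff_eq_empty.1 hne, measure_empty]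
  have hWt : ∀ t, |S.indicator (tiltWDE ρ H g β ϑ) t| ≤ w := by
    intro t
    by_cases ht : t ∈ S
    · rw [Set.indicator_of_mem ht]; exact hWb t ht
    · rw [Set.indicator_of_notMem ht, abs_zero]; exact hw0
  have hFS : ∀ t ∈ S, 0 ≤ β * plaqCostAt ρ x₁ 1 2 (cfgTDE ρ H β ϑ t) ∧ β * plaqCostAt ρ x₁ 1 2 (cfgTDE ρ H β ϑ t) ≤ M := fun t ht => by
    have h := beta_mul_plaqCostAt_mem_Icc_of_mem_goodTDE ρ hρu hβ0 ht.1 hPc.1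
    exact h
  have hGS : ∀ t ∈ S, 0 ≤ β * plaqCostAt ρ x₂ 1 2 (cfgTDE ρ H β ϑ t) ∧ β * plaqCostAt ρ x₂ 1 2 (cfgTDE ρ H β ϑ t) ≤ M := fun t ht => by
    have h := beta_mul_plaqCostAt_mem_Icc_of_mem_goodTDE ρ hρu hβ0 ht.1 hPc.2
    exact h
  have hSurF : ∀ t ∈ S, |β * plaqCostAt ρ x₁ 1 2 (cfgTDE ρ H β ϑ t) - 1 / 2 * ∑ c, (Fb c + dirCirc H (x₁, 1, 2) (t c)) ^ 2| ≤ τ := by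
    intro t ht
    have h := hSur₁ t ht
    rw [qObsDE_eq_half_sum_sq, abs_sub_comm] at h
    exact h
  have hSurG : ∀ t ∈ S, |β * plaqCostAt ρ x₂ 1 2 (cfgTDE ρ H β ϑ t) - 1 / 2 * ∑ c, (Gb c + dirCirc H (x₂, 1, 2) (t c)) ^ 2| ≤ τ := by
    intro t ht
    have h := hSur₂ t ht
    rw [qObsDE_eq_half_sum_sq, abs_sub_comm] at h
    exact h
  -- the abstract `D`-colour core with the Gaussian moments discharged
  have hcore := abs_kernelCovG_sub_gaussian_le_moments ρ hρu hρc (H := H) (D := dimE ρ) (β := β) W x₁ x₂ 1 2 1 2 hGm hG0 hpY hM0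
    (cfgTDE ρ H β ϑ) (measurable_cfgTDE ρ hρc hinj β ϑ) hSm hS0 hP (measurable_tiltWDE ρ hρc hinj hgm β ϑ) hWt hrepF hrepG hrepFG
    Fb Gb (x₁, 1, 2) (x₂, 1, 2) hτ hFS hGS hSurF hSurG
  -- the moment constants: `|F'_c|, |G'_c| ≤ R'`, `0 ≤ C(p,p) ≤ 1`
  obtain ⟨hv1, hv2⟩ := integral_dirCirc_sq_le_one_centre (H := H) hH hT
  have hC1 : boxDirProjKernel H (x₁, 1, 2) (x₁, 1, 2) ≤ 1 := by rw [integral_dirCirc_sq] at hv1; exact hv1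
  have hC2 : boxDirProjKernel H (x₂, 1, 2) (x₂, 1, 2) ≤ 1 := by rw [integral_dirCirc_sq] at hv2; exact hv2
  have hC1' : 0 ≤ boxDirProjKernel H (x₁, 1, 2) (x₁, 1, 2) := boxDirProjKernel_self_nonneg _
  have hC2' : 0 ≤ boxDirProjKernel H (x₂, 1, 2) (x₂, 1, 2) := boxDirProjKernel_self_nonneg _
  obtain ⟨hKsq, hK, hK'⟩ := moment_consts_le (D := dimE ρ) hR'0 hF₁ hF₂ hC1' hC1 hC2' hC2
  set A : ℝ := 2 * (dimE ρ : ℝ) * ∑ c, (Fb c ^ 4 + 3 * boxDirProjKernel H (x₁, 1, 2) (x₁, 1, 2) ^ 2) +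
    2 * (dimE ρ) * ∑ c, (Gb c ^ 4 + 3 * boxDirProjKernel H (x₂, 1, 2) (x₂, 1, 2) ^ 2) with hA
  set B : ℝ := (8 * (dimE ρ : ℝ) ^ 3 * ∑ c, (Fb c ^ 8 + 105 * boxDirProjKernel H (x₁, 1, 2) (x₁, 1, 2) ^ 4) +
    8 * (dimE ρ : ℝ) ^ 3 * ∑ c, (Gb c ^ 8 + 105 * boxDirProjKernel H (x₂, 1, 2) (x₂, 1, 2) ^ 4)) / 2 with hB
  set K₁ : ℝ := 2 * (dimE ρ) * (R' ^ 2 + 2) with hK₁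
  set K₂ : ℝ := 3 * (dimE ρ : ℝ) ^ 2 * (R' ^ 4 + 11) with hK₂
  have hsqP : 0 ≤ Real.sqrt P := Real.sqrt_nonneg _
  have hsqA : 0 ≤ Real.sqrt A := Real.sqrt_nonneg _
  have h1 : 2 * τ * (M + Real.sqrt A) ≤ 2 * τ * (M + K₁) :=
    mul_le_mul_of_nonneg_left (add_le_add le_rfl hK) (mul_nonneg (by norm_num) hτ)
  have h2 : Real.sqrt P * (2 * M * Real.sqrt A + Real.sqrt B + A) ≤ Real.sqrt P * (2 * M * K₁ + K₂ + K₁ ^ 2) :=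
    mul_le_mul_of_nonneg_left (add_le_add (add_le_add (mul_le_mul_of_nonneg_left hK (mul_nonneg (by norm_num) hM0)) hK') hKsq) hsqP
  have h6 : 6 * (2 * N * |β|) * (2 * N * |β|) * pY = 6 * (2 * N * β) * (2 * N * β) * pY := by rw [abs_of_pos hβ0]
  rw [h6] at hcore
  refine hcore.trans ?_
  linarith

end Box

end Summit.QuantumFields.YangMills.Theorems.ColdBoxAllGroups

end
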